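import Summits.Ventures.HodgeKum4.Theorems.KummerFixedLocusKummerPointAssembly
import HarnessLib

/-!
# Sections of a split object `⊔ₖ Spec ℂ` over `Spec ℂ` (cell `hodge-kum4`, seat p1 — plumbing for the point count)

If `x : Fin n → (Spec ℂ ⟶ F)` exhibits the `ℂ`-scheme `F` as the coproduct of `n` points (the shape of
Oguiso's fixed-point statement `Oguiso2020_fixedPointScheme_translation_generalizedKummerFour`), then

* `SplitPoints.exists_eq` — every section `t : Spec ℂ ⟶ F` IS one of the `x k`;
* `SplitPoints.injective` — the `x k` are pairwise distinct.

Proof: transfer the cofan to `Scheme` along `Over.forget` (a left adjoint), compare with Mathlib's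
`∐ (fun _ ↦ Spec ℂ)` whose points are `Σ k, Spec ℂ` (`sigmaMk`, `sigmaι_eq_iff`), and use seat p2's
`exists_fac_over` (coproducts of schemes are universal) with the empty fibres over `k ≠ k₀`.
HONEST FRAMING: category-theoretic plumbing; nothing about `K⁴(A)` is proved here.
-/

noncomputable section

open CategoryTheory CategoryTheory.Limits MonoidalCategory CartesianMonoidalCategory
open AlgebraicGeometry

namespace Summit.Ventures.HodgeKum4

namespace SplitPoints

variable {n : ℕ} {F : Literature.AlgebraicGeometry.Motives.SchemeOver ℂ}
  (x : Fin n → (𝟙_ (Literature.AlgebraicGeometry.Motives.SchemeOver ℂ) ⟶ F))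
  (hx : IsColimit (Cofan.mk F x))

/-- The underlying space of `Spec ℂ` (the terminal `ℂ`-scheme) has at most one point. -/
theorem subsingleton_unit : Subsingleton ↥((𝟙_ (Literature.AlgebraicGeometry.Motives.SchemeOver ℂ)).left) :=
  inferInstanceAs (Subsingleton (PrimeSpectrum ℂ))

/-- The underlying space of `Spec ℂ` is nonempty. -/
theorem nonempty_unit : Nonempty ↥((𝟙_ (Literature.AlgebraicGeometry.Motives.SchemeOver ℂ)).left) :=
  inferInstanceAs (Nonempty (PrimeSpectrum ℂ))

include hx in
/-- The image points of the sections `x k` of a split object determine `k`. -/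
theorem eq_of_base_eq {k k' : Fin n} (s s' : ↥((𝟙_ (Literature.AlgebraicGeometry.Motives.SchemeOver ℂ)).left))
    (h : (x k).left s = (x k').left s') : k = k' := by
  -- compare with the chosen coproduct `∐ (fun _ ↦ Spec ℂ)` in `Scheme`
  let f : Fin n → Scheme := fun _ ↦ (𝟙_ (Literature.AlgebraicGeometry.Motives.SchemeOver ℂ)).left
  have hx' : IsColimit (Cofan.mk F.left fun k => (x k).left) :=
    isColimitCofanMkObjOfIsColimit (Over.forget _) _ x hx
  let e : (∐ f) ≅ F.left := (coproductIsCoproduct f).coconePointUniqueUpToIso hx'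
  have he : ∀ k, Sigma.ι f k ≫ e.hom = (x k).left := fun k ↦
    (coproductIsCoproduct f).comp_coconePointUniqueUpToIso_hom hx' ⟨k⟩
  have h1 : e.hom ((Sigma.ι f k) s) = e.hom ((Sigma.ι f k') s') := by
    rw [← Scheme.Hom.comp_apply, ← Scheme.Hom.comp_apply, he, he]; exact h
  have h2 : (Sigma.ι f k) s = (Sigma.ι f k') s' := (Scheme.homeoOfIso e).injective h1
  have h3 := (sigmaι_eq_iff f k k' s s').mp h2
  exact congrArg Sigma.fst h3

include hx in
/-- **The sections of a split object are pairwise distinct.** -/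
theorem injective : Function.Injective x := by
  intro k k' h
  obtain ⟨s⟩ := nonempty_unit
  exact eq_of_base_eq x hx s s (by rw [h])

include hx in
/-- Every point of a split object is the image of one of the sections. -/
theorem exists_base_eq (y : ↥F.left) :
    ∃ (k : Fin n) (s : ↥((𝟙_ (Literature.AlgebraicGeometry.Motives.SchemeOver ℂ)).left)), (x k).left s = y := by
  let f : Fin n → Scheme := fun _ ↦ (𝟙_ (Literature.AlgebraicGeometry.Motives.SchemeOver ℂ)).left
  have hx' : IsColimit (Cofan.mk F.left fun k => (x k).left) :=
    isColimitCofanMkObjOfIsColimit (Over.forget _) _ x hx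
  let e : (∐ f) ≅ F.left := (coproductIsCoproduct f).coconePointUniqueUpToIso hx'
  have he : ∀ k, Sigma.ι f k ≫ e.hom = (x k).left := fun k ↦
    (coproductIsCoproduct f).comp_coconePointUniqueUpToIso_hom hx' ⟨k⟩
  obtain ⟨⟨k, s⟩, hks⟩ := (sigmaMk f).surjective (e.inv y)
  refine ⟨k, s, ?_⟩
  rw [sigmaMk_mk] at hks
  calc (x k).left s = (Sigma.ι f k ≫ e.hom) s := by rw [he]
    _ = e.hom ((Sigma.ι f k) s) := Scheme.Hom.comp_apply _ _ _
    _ = e.hom (e.inv y) := by rw [hks]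
    _ = y := (Scheme.homeoOfIso e).apply_symm_apply y

include hx in
/-- **Every section of a split object `⊔ₖ Spec ℂ → Spec ℂ` is one of the given sections.** -/
theorem exists_eq (t : 𝟙_ (Literature.AlgebraicGeometry.Motives.SchemeOver ℂ) ⟶ F) : ∃ k, t = x k := by
  classical
  haveI := subsingleton_unit
  obtain ⟨s₀⟩ := nonempty_unit
  obtain ⟨k₀, s, hs⟩ := exists_base_eq x hx (t.left s₀)
  refine ⟨k₀, ?_⟩
  -- the fibres of `t` over the other sections are empty
  have h0 : ∀ k, k ≠ k₀ → IsInitial (pullback t (x k)) := by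
    intro k hk
    haveI : IsEmpty ↥(pullback t (x k)).left := by
      refine ⟨fun z ↦ hk ?_⟩
      have hsq : (pullback.fst t (x k)).left ≫ t.left = (pullback.snd t (x k)).left ≫ (x k).left := by
        rw [← Over.comp_left, pullback.condition, Over.comp_left]
      have hz := congrArg (fun φ ↦ φ z) hsq
      simp only [Scheme.Hom.comp_apply] at hz
      rw [Subsingleton.elim ((pullback.fst t (x k)).left z) s₀, ← hs] at hz
      exact eq_of_base_eq x hx _ _ hz.symm
    exact (nonempty_isInitial_over_of_isEmpty _).some
  obtain ⟨u, hu⟩ := exists_fac_over x hx t (fun k => pullback t (x k)) (fun k => pullback.fst t (x k))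
    (fun k => pullback.snd t (x k)) (fun k => IsPullback.of_hasPullback t (x k)) k₀ h0
  rw [hu, toUnit_unique u (𝟙 _), Category.id_comp]

end SplitPoints

end Summit.Ventures.HodgeKum4

end
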